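import Mathlib

/-!
# SoloBlind — streak-centred κ-cells: the cell-to-disc covering inequality (engine L v0.3h, PLAN §121.18)

In the streak-centred treatment of a κ-cell the Taylor-model variable is `x_s = x - i κ g²`.  A physical
cell `|x - x₀| ≤ r`, `|κ - κ_c| ≤ δ`, `g ∈ [g_lo, g_hi]` (with `g_lo ≤ g_c ≤ g_hi`, `0 ≤ g_lo`) is covered by
the disc `|x_s - (x₀ - i κ_c g_c²)| ≤ r + δ g_hi² + |κ_c| · max (g_hi² - g_c²) (g_c² - g_lo²)`, which is the
radius `r_s` used by `engineL_box(kcen = "s")`.  This file proves that covering inequality.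
-/

namespace Summit.AnomalousDissipation.SoloBlind.StreakCentredCover

open Complex

/-- The κ g² bookkeeping: `|κ g² - κ_c g_c²| ≤ δ g_hi² + |κ_c| · max (g_hi² - g_c²) (g_c² - g_lo²)`. -/
theorem kappa_gsq_sub_le {κ κc δ g gc glo ghi : ℝ} (hκ : |κ - κc| ≤ δ)
    (hg : glo ≤ g ∧ g ≤ ghi) (hgc : glo ≤ gc ∧ gc ≤ ghi) (hglo : 0 ≤ glo) :
    |κ * g ^ 2 - κc * gc ^ 2| ≤ δ * ghi ^ 2 + |κc| * max (ghi ^ 2 - gc ^ 2) (gc ^ 2 - glo ^ 2) := by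
  have hg0 : 0 ≤ g := hglo.trans hg.1
  have hgc0 : 0 ≤ gc := hglo.trans hgc.1
  have h1 : g ^ 2 ≤ ghi ^ 2 := pow_le_pow_left₀ hg0 hg.2 2
  have h2 : glo ^ 2 ≤ g ^ 2 := pow_le_pow_left₀ hglo hg.1 2
  have h3 : gc ^ 2 ≤ ghi ^ 2 := pow_le_pow_left₀ hgc0 hgc.2 2
  have h4 : glo ^ 2 ≤ gc ^ 2 := pow_le_pow_left₀ hglo hgc.1 2
  have hsq : |g ^ 2 - gc ^ 2| ≤ max (ghi ^ 2 - gc ^ 2) (gc ^ 2 - glo ^ 2) := by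
    rcases le_or_gt (gc ^ 2) (g ^ 2) with h | h
    · rw [abs_of_nonneg (by linarith)]
      exact le_max_of_le_left (by linarith)
    · rw [abs_of_neg (by linarith)]
      exact le_max_of_le_right (by linarith)
  have hδ : 0 ≤ δ := (abs_nonneg _).trans hκ
  calc |κ * g ^ 2 - κc * gc ^ 2| = |(κ - κc) * g ^ 2 + κc * (g ^ 2 - gc ^ 2)| := by ring_nf
    _ ≤ |(κ - κc) * g ^ 2| + |κc * (g ^ 2 - gc ^ 2)| := abs_add_le _ _
    _ = |κ - κc| * g ^ 2 + |κc| * |g ^ 2 - gc ^ 2| := by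
        rw [abs_mul, abs_mul, abs_of_nonneg (pow_nonneg hg0 2)]
    _ ≤ δ * ghi ^ 2 + |κc| * max (ghi ^ 2 - gc ^ 2) (gc ^ 2 - glo ^ 2) := by
        gcongr

/-- Cell-to-disc covering: the streak-centred variable of every point of the physical cell lies in the
disc of radius `r + δ g_hi² + |κ_c| · max (g_hi² - g_c²) (g_c² - g_lo²)` about `x₀ - i κ_c g_c²`. -/
theorem streak_centred_cover {x x₀ : ℂ} {r κ κc δ g gc glo ghi : ℝ} (hx : ‖x - x₀‖ ≤ r)
    (hκ : |κ - κc| ≤ δ) (hg : glo ≤ g ∧ g ≤ ghi) (hgc : glo ≤ gc ∧ gc ≤ ghi) (hglo : 0 ≤ glo) :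
    ‖(x - I * (κ * g ^ 2 : ℝ)) - (x₀ - I * (κc * gc ^ 2 : ℝ))‖
      ≤ r + δ * ghi ^ 2 + |κc| * max (ghi ^ 2 - gc ^ 2) (gc ^ 2 - glo ^ 2) := by
  have hsplit : (x - I * (κ * g ^ 2 : ℝ)) - (x₀ - I * (κc * gc ^ 2 : ℝ))
      = (x - x₀) - I * ((κ * g ^ 2 - κc * gc ^ 2 : ℝ) : ℂ) := by
    push_cast; ring
  rw [hsplit]
  calc ‖(x - x₀) - I * ((κ * g ^ 2 - κc * gc ^ 2 : ℝ) : ℂ)‖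
      ≤ ‖x - x₀‖ + ‖I * ((κ * g ^ 2 - κc * gc ^ 2 : ℝ) : ℂ)‖ := norm_sub_le _ _
    _ = ‖x - x₀‖ + |κ * g ^ 2 - κc * gc ^ 2| := by
        rw [norm_mul, Complex.norm_I, one_mul, Complex.norm_real, Real.norm_eq_abs]
    _ ≤ r + (δ * ghi ^ 2 + |κc| * max (ghi ^ 2 - gc ^ 2) (gc ^ 2 - glo ^ 2)) :=
        add_le_add hx (kappa_gsq_sub_le hκ hg hgc hglo)
    _ = r + δ * ghi ^ 2 + |κc| * max (ghi ^ 2 - gc ^ 2) (gc ^ 2 - glo ^ 2) := by ring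

end Summit.AnomalousDissipation.SoloBlind.StreakCentredCover
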